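import Mathlib
import Literature.AlgebraicGeometry.Resolution.ComponentGluing
import HarnessLib

/-!
# Stalks of reduced induced closed subschemes over an open where a morphism is an isomorphism

Stub `stub_reducedStalkOverIso` of line `strata-split` of the crux `EquisingularLift`
(`stmt-ResolutionOfSingularities-15660`).

If `σ₂ : P₂ ⟶ P₁` is an isomorphism over the open `V ⊆ P₁` and the closed subsets `Z₂ ⊆ P₂`,
`Z₁ ⊆ P₁` agree over `V` (`Z₂ ∩ σ₂⁻¹V = σ₂⁻¹Z₁ ∩ σ₂⁻¹V`), then for a point `z` of the reduced
induced closed subscheme `V(Z₂)` lying over a point `x ∈ V` of `V(Z₁)`, the stalk of `V(Z₂)` at `z`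
is regular iff the stalk of `V(Z₁)` at `x` is.

Proof: restrict both closed immersions `V(Zᵢ) ↪ Pᵢ` over `σ₂ ⁻¹ V ≅ V`. Both restrictions are
closed immersions from REDUCED schemes into `V` with the same range, so they have the same kernel
— the kernel of a morphism from a reduced scheme is the vanishing ideal sheaf of the closure of its
range (`Scheme.IdealSheafData.map_vanishingIdeal` at the nilradical) — hence are isomorphic over `V`
(`IsClosedImmersion.isIso_lift`); the isomorphism sends `z` to `x` (closed immersions are
injective) and induces an isomorphism of stalks, and stalks of open subschemes are stalks of the
ambient scheme (`Scheme.Opens.stalkIso`). Regularity is transported by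
`IsRegularLocalRing.of_ringEquiv`.

References: U. Görtz, T. Wedhorn, *Algebraic Geometry I*, 2nd ed. (2020), Prop. 13.91 (3) (local
rings do not change where a morphism restricts to an isomorphism) [GortzWedhorn2020]; the reduced
induced closed subscheme structure and its uniqueness, Stacks Project Tag 01J3.
-/

set_option linter.dupNamespace false -- mandated namespace of this single-conjunct summit

open CategoryTheory AlgebraicGeometry TopologicalSpace

namespace Summit.ResolutionOfSingularities.ResolutionOfSingularities.Cruxes.EquisingularLift.StrataSplit

open Scheme.IdealSheafData Literature.AlgebraicGeometry.Resolution

universe u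

/-- Regularity of (local) rings is invariant under isomorphisms of commutative rings. -/
private theorem isRegularLocalRing_iff_of_iso {A B : CommRingCat.{u}} (e : A ≅ B) :
    IsRegularLocalRing A ↔ IsRegularLocalRing B :=
  ⟨fun _ => IsRegularLocalRing.of_ringEquiv e.commRingCatIsoToRingEquiv,
    fun _ => IsRegularLocalRing.of_ringEquiv e.commRingCatIsoToRingEquiv.symm⟩

/-- The kernel of a morphism from a reduced scheme is the vanishing ideal sheaf of the closure of
its range. -/
private theorem ker_eq_vanishingIdeal_closure_range {A Y : Scheme.{u}} (g : A ⟶ Y) [IsReduced A] :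
    g.ker = vanishingIdeal (.closure (Set.range g)) := by
  rw [← map_bot, ← Scheme.nilradical_eq_bot, ← vanishingIdeal_top, map_vanishingIdeal,
    Closeds.coe_top, Set.image_univ]

/-- Two morphisms from reduced schemes with the same range have the same kernel. -/
private theorem ker_eq_ker_of_range_eq {A B Y : Scheme.{u}} (f : A ⟶ Y) (g : B ⟶ Y) [IsReduced A]
    [IsReduced B] (h : Set.range f = Set.range g) : f.ker = g.ker := by
  rw [ker_eq_vanishingIdeal_closure_range, ker_eq_vanishingIdeal_closure_range, h]

/-- Two closed immersions from reduced schemes with the same range are isomorphic over the target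
(`IsClosedImmersion.isIso_lift`), so their stalks at corresponding points are isomorphic; in
particular one is a regular local ring iff the other is. -/
private theorem isRegularLocalRing_stalk_iff_of_range_eq {A₁ A₂ Y : Scheme.{u}} (g₁ : A₁ ⟶ Y)
    (g₂ : A₂ ⟶ Y) [IsClosedImmersion g₁] [IsClosedImmersion g₂] [IsReduced A₁] [IsReduced A₂]
    (h : Set.range g₁ = Set.range g₂) {a₁ : A₁} {a₂ : A₂} (ha : g₂ a₂ = g₁ a₁) :
    IsRegularLocalRing (A₂.presheaf.stalk a₂) ↔ IsRegularLocalRing (A₁.presheaf.stalk a₁) := by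
  have hker : g₁.ker = g₂.ker := ker_eq_ker_of_range_eq g₁ g₂ h
  haveI := IsClosedImmersion.isIso_lift g₁ g₂ hker
  have hφ : IsClosedImmersion.lift g₁ g₂ hker.le a₂ = a₁ := by
    apply g₁.isClosedEmbedding.injective
    rw [← Scheme.Hom.comp_apply, IsClosedImmersion.lift_fac, ha]
  rw [← isRegularLocalRing_iff_of_iso
    (asIso ((IsClosedImmersion.lift g₁ g₂ hker.le).stalkMap a₂)), hφ]

/-- **`stub_reducedStalkOverIso`.** If `σ₂ : P₂ → P₁` is an isomorphism over the open `V ⊆ P₁`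
and the closed sets `Z₂ ⊆ P₂`, `Z₁ ⊆ P₁` agree over `V` (`Z₂ ∩ σ₂⁻¹V = σ₂⁻¹Z₁ ∩ σ₂⁻¹V`), then
for a point `z` of the reduced induced closed subscheme `V(Z₂)` lying over a point `x` of `V(Z₁)`
with `x ∈ V`, the stalk of `V(Z₂)` at `z` is regular iff the stalk of `V(Z₁)` at `x` is (both
reduced closed subschemes restrict, over `σ₂⁻¹V ≅ V`, to THE reduced closed subscheme on the same
closed set). -/
theorem stub_reducedStalkOverIso : ∀ (P₁ P₂ : AlgebraicGeometry.Scheme.{0}) (σ₂ : P₂ ⟶ P₁) (V : P₁.Opens),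
    CategoryTheory.IsIso (σ₂ ∣_ V) →
    ∀ (Z₁ : TopologicalSpace.Closeds P₁) (Z₂ : TopologicalSpace.Closeds P₂),
    (Z₂ : Set P₂) ∩ σ₂ ⁻¹' (V : Set P₁) = σ₂ ⁻¹' (Z₁ : Set P₁) ∩ σ₂ ⁻¹' (V : Set P₁) →
    ∀ (z : ↥(AlgebraicGeometry.Scheme.IdealSheafData.vanishingIdeal Z₂).subscheme)
      (x : ↥(AlgebraicGeometry.Scheme.IdealSheafData.vanishingIdeal Z₁).subscheme),
    (σ₂ ((AlgebraicGeometry.Scheme.IdealSheafData.vanishingIdeal Z₂).subschemeι z) : P₁) =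
      (AlgebraicGeometry.Scheme.IdealSheafData.vanishingIdeal Z₁).subschemeι x →
    ((AlgebraicGeometry.Scheme.IdealSheafData.vanishingIdeal Z₁).subschemeι x : P₁) ∈ V →
    (IsRegularLocalRing ((AlgebraicGeometry.Scheme.IdealSheafData.vanishingIdeal Z₂).subscheme.presheaf.stalk z) ↔
      IsRegularLocalRing ((AlgebraicGeometry.Scheme.IdealSheafData.vanishingIdeal Z₁).subscheme.presheaf.stalk x)) := by
  intro P₁ P₂ σ₂ V hiso Z₁ Z₂ hZ z x hzx hxV
  haveI := ComponentGluing.isReduced_subscheme_vanishingIdeal Z₁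
  haveI := ComponentGluing.isReduced_subscheme_vanishingIdeal Z₂
  have hzW : (vanishingIdeal Z₂).subschemeι z ∈ σ₂ ⁻¹ᵁ V :=
    show σ₂ ((vanishingIdeal Z₂).subschemeι z) ∈ V by rw [hzx]; exact hxV
  -- the ranges of the two restricted closed immersions into `V` are both `Z₁ ∩ V`
  have hr₁ : Set.range ((vanishingIdeal Z₁).subschemeι ∣_ V) = Subtype.val ⁻¹' (Z₁ : Set P₁) := by
    ext v
    constructor
    · rintro ⟨a, rfl⟩
      show (((vanishingIdeal Z₁).subschemeι ∣_ V) a).1 ∈ (Z₁ : Set P₁)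
      rw [morphismRestrict_base_coe]
      exact ComponentGluing.mem_of_subscheme_vanishingIdeal Z₁ a.1
    · intro hv
      obtain ⟨y, hy⟩ : v.1 ∈ Set.range (vanishingIdeal Z₁).subschemeι := by
        rw [ComponentGluing.range_subschemeι_vanishingIdeal]; exact hv
      refine ⟨⟨y, show (vanishingIdeal Z₁).subschemeι y ∈ V by rw [hy]; exact v.2⟩,
        Subtype.ext ?_⟩
      rw [morphismRestrict_base_coe]
      exact hy
  have hr₂ : Set.range ((vanishingIdeal Z₂).subschemeι ∣_ (σ₂ ⁻¹ᵁ V) ≫ σ₂ ∣_ V) =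
      Subtype.val ⁻¹' (Z₁ : Set P₁) := by
    ext v
    constructor
    · rintro ⟨a, rfl⟩
      show (((vanishingIdeal Z₂).subschemeι ∣_ (σ₂ ⁻¹ᵁ V) ≫ σ₂ ∣_ V) a).1 ∈ (Z₁ : Set P₁)
      rw [Scheme.Hom.comp_apply, morphismRestrict_base_coe, morphismRestrict_base_coe]
      have h1 : ((vanishingIdeal Z₂).subschemeι a.1 : P₂) ∈ (Z₂ : Set P₂) ∩ σ₂ ⁻¹' (V : Set P₁) :=
        ⟨ComponentGluing.mem_of_subscheme_vanishingIdeal Z₂ a.1, a.2⟩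
      rw [hZ] at h1
      exact h1.1
    · intro hv
      obtain ⟨w, hw⟩ := (σ₂ ∣_ V).homeomorph.surjective v
      rw [Scheme.Hom.homeomorph_apply] at hw
      have hw1 : σ₂ w.1 = v.1 := by rw [← morphismRestrict_base_coe σ₂ V w, hw]
      have h1 : w.1 ∈ σ₂ ⁻¹' (Z₁ : Set P₁) ∩ σ₂ ⁻¹' (V : Set P₁) :=
        ⟨show σ₂ w.1 ∈ (Z₁ : Set P₁) by rw [hw1]; exact hv, w.2⟩
      rw [← hZ] at h1
      obtain ⟨c, hc⟩ : w.1 ∈ Set.range (vanishingIdeal Z₂).subschemeι := by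
        rw [ComponentGluing.range_subschemeι_vanishingIdeal]; exact h1.1
      refine ⟨⟨c, show (vanishingIdeal Z₂).subschemeι c ∈ σ₂ ⁻¹ᵁ V by rw [hc]; exact w.2⟩, ?_⟩
      rw [Scheme.Hom.comp_apply, ← hw]
      congr 1
      apply Subtype.ext
      rw [morphismRestrict_base_coe]
      exact hc
  have key := isRegularLocalRing_stalk_iff_of_range_eq ((vanishingIdeal Z₁).subschemeι ∣_ V)
    ((vanishingIdeal Z₂).subschemeι ∣_ (σ₂ ⁻¹ᵁ V) ≫ σ₂ ∣_ V) (hr₁.trans hr₂.symm)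
    (a₁ := ⟨x, hxV⟩) (a₂ := ⟨z, hzW⟩) (by
      apply Subtype.ext
      rw [Scheme.Hom.comp_apply, morphismRestrict_base_coe, morphismRestrict_base_coe,
        morphismRestrict_base_coe]
      exact hzx)
  have e₂ := isRegularLocalRing_iff_of_iso
    (((vanishingIdeal Z₂).subschemeι ⁻¹ᵁ (σ₂ ⁻¹ᵁ V)).stalkIso ⟨z, hzW⟩)
  have e₁ := isRegularLocalRing_iff_of_iso (((vanishingIdeal Z₁).subschemeι ⁻¹ᵁ V).stalkIso ⟨x, hxV⟩)
  exact e₂.symm.trans (key.trans e₁)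

end Summit.ResolutionOfSingularities.ResolutionOfSingularities.Cruxes.EquisingularLift.StrataSplit
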